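import Mathlib
import Literature.NumberTheory.Transcendental.GammaFields
import Summits.Schanuel.Schanuel.Theorems.RigidCoreAclSubsetLogFreeCoreCaseIIExpandCoprime
import Summits.Schanuel.Schanuel.Theorems.RigidCoreAclSubsetLogFreeCoreCaseIIMonomialDvd
import Summits.Schanuel.Schanuel.Theorems.RigidCoreAclSubsetLogFreeCoreCaseIIFractions
import Summits.Schanuel.Schanuel.Theorems.RigidCoreAclSubsetLogFreeCoreCaseIIDenominator
import Summits.Schanuel.Schanuel.Theorems.RigidCoreAclSubsetLogFreeCoreCaseIIInduction

/-!
# Case II core, file 9: the core claim `stub_caseII_core`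
(registered stub of line `eac-extends-core-automorphisms`, crux stmt-Schanuel-0968
`Summit.Schanuel.Schanuel.Theses.RigidCore.AclSubsetLogFreeCore`)

**The core claim ("difference algebra of a branch shift").**  In an algebraically closed
exponential field `E` of characteristic `0` with cyclic kernel `τℤ`, let `X ∋ τ` be a finitely
generated strong `ℚ`-subspace, `ℓ` an L-step over `X` (`exp ℓ` algebraic over the Γ-field
`ℚ(gens X)`, `ℓ` not), `U = (X + ℚℓ) + ℚ(v)` an A-extension (each `vᵢ` algebraic over the Γ-field
of the previous space) in which `X` is A-closed, and `θ` an exponential ring automorphism of `E`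
which is the identity on `X`, shifts the branch `θ ℓ = ℓ + q τ` (`q ≠ 0`) and stabilises `U`.
Then every `θ`-fixed element of `U` lies in `X`.

Proof: the level induction `CaseIICore.level_induction` (file 8) over the canonical tower
`Y 0 = X + ℚℓ`, `Y (s+1) = U ⊓ span (acl (gens (Y s)))`, with the fraction facts supplied by the
landed stubs `stub_caseII_fractions`, `stub_caseII_denominator` (+ `stub_caseII_expandCoprime`,
`stub_caseII_monomialDvd`); the tower exhausts `U` (`tower_exhausts`), so a fixed `a ∈ U` descends
level by level to `Y 0 = X + ℚℓ`, where fixed elements visibly lie in `X`.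
-/

noncomputable section

set_option linter.dupNamespace false

open Set
open scoped BigOperators
open Literature.ModelTheory.ExponentialFields Literature.ModelTheory.ExponentialFields.ExponentialRing
open Literature.NumberTheory.Transcendental Literature.NumberTheory.Transcendental.GammaField

namespace Summit.Schanuel.Schanuel.Theorems.RigidCore

open CaseIICore

/-- **Stub `stub_caseII_core` — Case II, the core claim** (see the module docstring): every
`θ`-fixed element of the A-extension `U` of `X + ℚℓ` lies in `X`, for `θ` an exponential
automorphism fixing `X`, shifting the branch `ℓ` by `q τ ≠ 0` and stabilising `U`.
[cite: BaysKirby2018ANT, Lemma 4.8, §4.4] -/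
theorem stub_caseII_core {E : Type} [Field E] [CharZero E] [ExponentialRing E] [IsAlgClosed E]
    (τ : E) (hker : expKernel E = AddSubgroup.zmultiples τ) (hτ : τ ≠ 0)
    (X : Submodule ℚ E) (hτX : τ ∈ X) (hXfg : X.FG) (hXs : IsStrong X)
    (ℓ : E) (hℓexp : exp ℓ ∈ acl (gens X)) (hℓ : ℓ ∉ acl (gens X))
    (U : Submodule ℚ E) {s : ℕ} (v : Fin s → E)
    (hU : U = (X ⊔ Submodule.span ℚ {ℓ}) ⊔ Submodule.span ℚ (range v))
    (hvA : ∀ i : Fin s,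
      v i ∉ (X ⊔ Submodule.span ℚ {ℓ}) ⊔ Submodule.span ℚ (v '' Set.Iio i) ∧
      v i ∈ acl (gens ((X ⊔ Submodule.span ℚ {ℓ}) ⊔ Submodule.span ℚ (v '' Set.Iio i))))
    (hXclosed : ∀ u ∈ U, u ∈ acl (gens X) → u ∈ X)
    (θ : E ≃+* E) (hθexp : ∀ x, θ (exp x) = exp (θ x)) (hθX : ∀ x ∈ X, θ x = x)
    (q : ℚ) (hq : q ≠ 0) (hθℓ : θ ℓ = ℓ + q • τ)
    (hθU : ∀ u, u ∈ U ↔ θ u ∈ U) :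
    ∀ a ∈ U, θ a = a → a ∈ X := by
  classical
  have _hXfg : X.FG := hXfg  -- (registered hypothesis, not needed by the proof)
  intro a haU hfix
  -- kernel facts
  have hτ1 : exp τ = 1 := (exp_eq_one_iff_of_kernel hker τ).2 ⟨1, by rw [Int.cast_one, one_smul]⟩
  have hker' : ∀ z, exp z = 1 → ∃ m : ℤ, z = (m : ℚ) • τ := fun z hz =>
    (exp_eq_one_iff_of_kernel hker z).1 hz
  -- the canonical tower of `V = X + ℚℓ ≤ U`
  set Y : ℕ → Submodule ℚ E := fun n =>
    Nat.rec (X ⊔ Submodule.span ℚ {ℓ}) (fun _ Ys => U ⊓ Submodule.span ℚ (acl (gens Ys))) n with hYdef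
  have hY0 : Y 0 = X ⊔ Submodule.span ℚ {ℓ} := rfl
  have hYs : ∀ n, Y (n + 1) = U ⊓ Submodule.span ℚ (acl (gens (Y n))) := fun n => rfl
  have hvA' : ∀ i : Fin s, v i ∈ acl (gens ((X ⊔ Submodule.span ℚ {ℓ}) ⊔
      Submodule.span ℚ (v '' Set.Iio i))) := fun i => (hvA i).2
  -- the level induction, with the fraction facts from the landed stubs
  have IH := fun n => level_induction hτ hτ1 hker' hτX hXs hℓexp hℓ v hU hvA' hXclosed hY0 hYs
    (fun k Y' Y'' p b hbspan hexpY' z hz => stub_caseII_fractions k b hbspan hexpY' hz)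
    (fun k Y' Y'' p b hk hbspan hbY hexpY' hAI Θ hΘexp hΘk hΘY'' N hN z P Q hrel hQ hz c₀ y₀ hc₀ hc₀0
        hy₀ hsemi => by
      haveI := isAlgClosed_subfield_of_forall_mem k hk
      exact stub_caseII_denominator k b hbspan hbY hexpY' hAI
        (fun he _ _ h => stub_caseII_expandCoprime he h) (fun hc h => stub_caseII_monomialDvd hc h)
        Θ hΘexp hΘk hΘY'' hN hrel hQ hz hc₀ hc₀0 hy₀ hsemi) n
  -- the tower exhausts `U`; descend
  have hVU : X ⊔ Submodule.span ℚ {ℓ} ≤ U := by rw [hU]; exact le_sup_left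
  have hfg : IsFG (X ⊔ Submodule.span ℚ {ℓ}) U := by
    rw [hU, isFG_sup_left]; exact isFG_span_of_finite _ (finite_range v)
  obtain ⟨T, hT⟩ := tower_exhausts hfg hVU hY0 hYs v hU hvA'
  have hdesc : ∀ n, a ∈ Y n → a ∈ Y 0 := by
    intro n
    induction n with
    | zero => exact id
    | succ n ih => exact fun h => ih ((IH n).1 θ hθexp hθX q hq hθℓ hθU a h hfix)
  have ha0 : a ∈ X ⊔ Submodule.span ℚ {ℓ} := by rw [← hY0]; exact hdesc T (by rw [hT]; exact haU)
  -- fixed elements of `X + ℚℓ` lie in `X`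
  obtain ⟨x, hx, z, hz, rfl⟩ := Submodule.mem_sup.1 ha0
  obtain ⟨r, rfl⟩ := Submodule.mem_span_singleton.1 hz
  have hr : r = 0 := by
    have h1 : θ (x + r • ℓ) = (x + r • ℓ) + (r * q) • τ := by
      rw [map_add, hθX x hx, map_rat_smul, hθℓ, smul_add, smul_smul, add_assoc]
    rw [hfix] at h1
    have h2 : (r * q) • τ = 0 := by
      have := congrArg (fun w => w - (x + r • ℓ)) h1
      simpa using this.symm
    rcases smul_eq_zero.1 h2 with h | h
    · exact (mul_eq_zero.1 h).resolve_right hq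
    · exact absurd h hτ
  rw [hr, zero_smul, add_zero]
  exact hx

end Summit.Schanuel.Schanuel.Theorems.RigidCore
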